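import Summits.ValiantsHypothesis.ValiantsHypothesis.Theorems.NewtonUnitEquationsTwoProductsConfinedTameLawDefs

/-!
# Line `relation_ladder` — rung R10 «positive-circuit chart / ConfinedTameLaw C»: the RUNG STATEMENT of record (Cruxes sketch, no stubs, no sorry)

Cruxes record written by the 5906 pen (val-port-1 g2→g3; desk g13 RULINGS #316/#317/#318/#325, director R275/R282).  ONE SOURCE OF TRUTH: the
definitions `toZ`, `realisedDiffs`, `relLattice`, `InSat`, `LetterConfined`, `FibreSpread`, `SliceCountBound` and the rung statement
`ConfinedTameLaw (C : ℕ) : Prop` live in the Theorems module `…Theorems.NewtonUnitEquations.TwoProducts.PermutationType.R10Defs`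
(`Theorems/NewtonUnitEquationsTwoProductsConfinedTameLawDefs.lean`, texts = val-idea-37 g0's `pub/ideators/val-idea-37/Sketch.lean`
ll. 43–87 verbatim, filed by val-lit-p3 g16 under desk #317; critic of record val-idea-crit-8, verdict #2; pre-audit val-neg-1 g5 PASS AS TYPED);
this file only RE-EXPORTS the rung by name so that a future `relation_ladder` v22 can register
`stub_confinedTame (C) : R10Rung C := R10.confinedTameLaw_holds C` (val-lit-p3 g16's bridge theorem) by δ.
SCOPE LABEL (R275 P3): a proper POSITIVE SUB-CASE rung (confined + tame relation lattices, any coincidence rank, no datum), NOT the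
residual `ResidualLawV21`; nothing here closes 5906; VP ≠ VNP is NOT proved.
-/

set_option linter.dupNamespace false

namespace Summit.ValiantsHypothesis.ValiantsHypothesis.Cruxes.TwoProducts.RelationLadder.R10Sketch

/-- **R10 rung** `ConfinedTameLaw C`, by name from Theorems (one source of truth). -/
def R10Rung (C : ℕ) : Prop :=
  Summit.ValiantsHypothesis.ValiantsHypothesis.Theorems.NewtonUnitEquations.TwoProducts.PermutationType.R10Defs.ConfinedTameLaw C

/-- The re-export unfolds definitionally to the Theorems statement. -/
theorem r10Rung_iff (C : ℕ) : R10Rung C ↔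
    Summit.ValiantsHypothesis.ValiantsHypothesis.Theorems.NewtonUnitEquations.TwoProducts.PermutationType.R10Defs.ConfinedTameLaw C :=
  Iff.rfl

end Summit.ValiantsHypothesis.ValiantsHypothesis.Cruxes.TwoProducts.RelationLadder.R10Sketch
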